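import Mathlib
import Literature.RingTheory.CohomologyAnnihilator.ReductionModRegular
import Literature.RingTheory.CohomologyAnnihilator.StableAnnihilation
import Literature.RingTheory.CohomologyAnnihilator.StrongGenerator
import HarnessLib

/-!
# H-e: the cohomology annihilator through reduction modulo a nonzerodivisor

Crux `HomologicalConductor.Persistence` (stmt-ResolutionOfSingularities-16484), chain W4.4b, plan of
record `L/w44b/CHAIN.md` v0.2 / `PlanSignatures.lean` v0.2 (`H_e_reductionModX`, stub-2): the
mechanism M-E ("reduction mod `x`") every exponent-one argument for the core stub passes through.

**Theorem (`H_e_reductionModX`, binders verbatim the planner's).** For a commutative noetherian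
ring `C` and a nonzerodivisor `x ∈ C`:
`x ∈ ca(C)` **iff** there is an `n` such that every `(n+1)`-th syzygy module `N` of a finitely
generated `C`-module is a retract of a first syzygy module of `N/xN`.

* `⇒`: `x ∈ caˢ(C)` for some `s`; an `(s+1)`-th syzygy `N = Ωˢ⁺¹X` embeds in a finitely generated
  projective, so it is finitely generated and `x` is `N`-regular, and `x · Ext¹_C(N, –) = 0` on
  finitely generated modules by dimension shifting (`x` kills `Ext^{s+2}_C(X, –)`); then
  [IyengarTakahashi2014, Remark 2.12] (tree `exists_retract_isSyzygy_quotSMulTop`) makes `N` a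
  retract of a first syzygy of `N/xN`.
* `⇐`: `x` acts as `0` on `N/xN`, so `x · Extʲ⁺¹_C(N/xN, –) = 0`, hence `x · Extʲ_C(L, –) = 0`
  (`j ≥ 1`) for a first syzygy `L` of `N/xN` (dimension shifting), hence for the retract `N`, hence
  `x · Ext^{j+n+1}_C(X, –) = 0` on finitely generated modules: `x ∈ ca^{n+2}(C)`.

`[OURS · L1 w44b]`: a reformulation lemma of OUR chain (folklore homological algebra around
[IyengarTakahashi2014, Rem. 2.12] and [DaoTakahashi2014, Lemma 5.6]); not a statement of any
manuscript.

References: S. B. Iyengar, R. Takahashi, *Annihilation of cohomology and strong generation of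
module categories*, IMRN 2016, Remark 2.12 [`IyengarTakahashi2014`]; H. Dao, R. Takahashi,
*The radius of a subcategory of modules*, ANT 8 (2014), Lemma 5.6 [`DaoTakahashi2014`].
-/

-- single-problem summit: the doubled namespace component is forced
set_option linter.dupNamespace false

noncomputable section

open CategoryTheory CategoryTheory.Abelian
open scoped Pointwise nonZeroDivisors

namespace Summit.ResolutionOfSingularities.ResolutionOfSingularities.Theorems.HomologicalConductor.PersistenceReductionModX

open Literature.RingTheory.CohomologyAnnihilator

variable {C : Type} [CommRing C]

/-! ## Bookkeeping on syzygies -/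

/-- A positive syzygy embeds in a finitely generated projective: if `N` is an `(n+1)`-th syzygy of
`X` then there are a finitely generated projective `P` and a monomorphism `N ⟶ P`. [folklore] -/
theorem exists_mono_of_isSyzygy_succ {n : ℕ} {X N : ModuleCat.{0} C} (hN : IsSyzygy (n + 1) X N) :
    ∃ (P : ModuleCat.{0} C) (f : N ⟶ P), Module.Finite C P ∧ Projective P ∧
      Function.Injective f := by
  obtain ⟨K', P, -, hP, hproj, f, g, w, hS⟩ := hN
  refine ⟨P, f, hP, hproj, ?_⟩
  haveI := hS.mono_f
  exact (ModuleCat.mono_iff_injective f).mp inferInstance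

/-- Over a noetherian ring a positive syzygy of anything is finitely generated (it embeds in a
finitely generated projective). [folklore] -/
theorem finite_of_isSyzygy_succ [IsNoetherianRing C] {n : ℕ} {X N : ModuleCat.{0} C}
    (hN : IsSyzygy (n + 1) X N) : Module.Finite C N := by
  obtain ⟨P, f, hP, -, hf⟩ := exists_mono_of_isSyzygy_succ hN
  haveI := hP
  exact Module.Finite.of_injective f.hom hf

/-- A nonzerodivisor of `C` is regular on every positive syzygy (which embeds in a projective,
on which nonzerodivisors are regular). [cite: DaoTakahashi2014, Lemma 5.6] -/
theorem isSMulRegular_of_isSyzygy_succ {x : C} (hx : x ∈ C⁰) {n : ℕ} {X N : ModuleCat.{0} C}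
    (hN : IsSyzygy (n + 1) X N) : IsSMulRegular N x := by
  obtain ⟨P, f, -, hproj, hf⟩ := exists_mono_of_isSyzygy_succ hN
  exact isSMulRegular_of_injective f.hom hf (isSMulRegular_of_projective hx P hproj)

/-! ## `x` kills every `Ext` out of `N/xN` -/

/-- The homothety `x • 𝟙` of `N/xN` is zero. [folklore] -/
theorem smul_id_quotSMulTop_eq_zero (x : C) (N : ModuleCat.{0} C) :
    x • 𝟙 (ModuleCat.of C (N ⧸ (x • (⊤ : Submodule C N)))) = 0 := by
  apply ModuleCat.hom_ext
  apply LinearMap.ext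
  intro q
  obtain ⟨m, rfl⟩ := Submodule.Quotient.mk_surjective (x • (⊤ : Submodule C N)) q
  change x • (Submodule.Quotient.mk m : N ⧸ (x • (⊤ : Submodule C N))) = 0
  rw [← Submodule.Quotient.mk_smul, Submodule.Quotient.mk_eq_zero]
  exact Submodule.smul_mem_pointwise_smul m x ⊤ trivial

/-- `x` kills `Extʲ_C(N/xN, Y)` for every `Y` and `j`: the scalar action is precomposition with the
homothety `x • 𝟙 (N/xN) = 0`. [folklore] -/
theorem smul_ext_quotSMulTop_eq_zero (x : C) (N Y : ModuleCat.{0} C) {j : ℕ}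
    (e : Ext.{0} (ModuleCat.of C (N ⧸ (x • (⊤ : Submodule C N)))) Y j) : x • e = 0 := by
  rw [smul_eq_mk₀_smul_id_comp, smul_id_quotSMulTop_eq_zero, Ext.mk₀_zero, Ext.zero_comp]

/-! ## The equivalence -/

/-- **H-e, `⇒`.** If `x ∈ ca(C)` is a nonzerodivisor of the noetherian ring `C`, then for some `n`
every `(n+1)`-th syzygy `N` of a finitely generated module is a retract of a first syzygy of
`N/xN`: take `n = s` with `x ∈ caˢ(C)`; `x` is `N`-regular and kills `Ext¹_C(N, –)` on finitely
generated modules (dimension shifting from `Ext^{s+2}_C(X, –)`), so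
[IyengarTakahashi2014, Remark 2.12] applies. [cite: IyengarTakahashi2014, Remark 2.12] -/
theorem exists_forall_isSyzygy_retract_of_mem [IsNoetherianRing C] {x : C} (hx : x ∈ C⁰)
    (hca : x ∈ cohomologyAnnihilator C) :
    ∃ n : ℕ, ∀ (X N : ModuleCat.{0} C), Module.Finite C X → IsSyzygy (n + 1) X N →
      ∃ L : ModuleCat.{0} C, IsSyzygy 1 (ModuleCat.of C (N ⧸ (x • (⊤ : Submodule C N)))) L ∧
        ∃ (i : N ⟶ L) (p : L ⟶ N), i ≫ p = 𝟙 N := by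
  obtain ⟨s, hs⟩ := mem_cohomologyAnnihilator_iff.mp hca
  refine ⟨s, fun X N hX hN => ?_⟩
  haveI := hX
  haveI : Module.Finite C N := finite_of_isSyzygy_succ hN
  have hreg : IsSMulRegular N x := isSMulRegular_of_isSyzygy_succ hx hN
  refine exists_retract_isSyzygy_quotSMulTop hreg fun Y hY e => ?_
  haveI := hY
  exact ext_smul_eq_zero_of_isSyzygy (s + 1) hN Y 1 le_rfl x
    (fun e' => smul_eq_zero_of_mem_cohomologyAnnihilatorOfDegree hs (by omega) e') e

/-- **H-e, `⇐`.** If for some `n` every `(n+1)`-th syzygy `N` of a finitely generated module is a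
retract of a first syzygy of `N/xN`, then `x ∈ ca^{n+2}(C)` (no hypothesis on `x`): `x` kills
`Ext_C(N/xN, –)`, hence `Extʲ_C(L, –)` for `j ≥ 1` and a first syzygy `L` of `N/xN`, hence
`Extʲ_C(N, –)` for the retract `N`, hence `Ext^{j+n+1}_C(X, –)`. [cite: IyengarTakahashi2014, Remark 2.12] -/
theorem mem_cohomologyAnnihilatorOfDegree_of_forall_isSyzygy_retract [IsNoetherianRing C] {x : C}
    {n : ℕ}
    (h : ∀ (X N : ModuleCat.{0} C), Module.Finite C X → IsSyzygy (n + 1) X N →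
      ∃ L : ModuleCat.{0} C, IsSyzygy 1 (ModuleCat.of C (N ⧸ (x • (⊤ : Submodule C N)))) L ∧
        ∃ (i : N ⟶ L) (p : L ⟶ N), i ≫ p = 𝟙 N) :
    x ∈ cohomologyAnnihilatorOfDegree C (n + 2) := by
  rw [mem_cohomologyAnnihilatorOfDegree_iff]
  intro i hi X Y hX hY e
  -- an `(n+1)`-th syzygy `N` of `X`, a first syzygy `L` of `N/xN`, and the retraction
  obtain ⟨N, hNfin, hN⟩ := exists_isSyzygy X (n + 1)
  obtain ⟨L, hL, ι, π, hιπ⟩ := h X N hX hN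
  -- `x` kills `Extʲ_C(N, –)` for `j ≥ 1`
  have hNkill : x ∈ extAnnihilatorFrom N 1 := by
    rw [mem_extAnnihilatorFrom_iff]
    intro j hj Y' hY' e'
    refine ext_smul_eq_zero_of_retract ι π hιπ x (fun eL => ?_) e'
    exact ext_smul_eq_zero_of_isSyzygy 1 hL Y' j hj x
      (fun e'' => smul_ext_quotSMulTop_eq_zero x N Y' e'') eL
  -- shift back up along `N = Ωⁿ⁺¹ X`
  have hXkill : x ∈ extAnnihilatorFrom X (1 + (n + 1)) :=
    mem_extAnnihilatorFrom_of_isSyzygy (n + 1) hN hNkill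
  exact (mem_extAnnihilatorFrom_iff.mp hXkill) i (by omega) Y hY e

/-- **H-e (CHAIN.md v0.2, `PlanSignatures.lean` v0.2 `H_e_reductionModX`, binders verbatim).** For
a noetherian ring `C` and a nonzerodivisor `x`: `x ∈ ca(C)` iff for some `n`, every `(n+1)`-th
syzygy module `N` of a finitely generated module is a retract of a first syzygy of `N/xN`.
[cite: IyengarTakahashi2014, Remark 2.12] -/
theorem H_e_reductionModX (C : Type) [CommRing C] [IsNoetherianRing C] (x : C)
    (hx : x ∈ nonZeroDivisors C) :
    x ∈ Literature.RingTheory.CohomologyAnnihilator.cohomologyAnnihilator C ↔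
      ∃ n : ℕ, ∀ (X N : ModuleCat.{0} C), Module.Finite C X →
        Literature.RingTheory.CohomologyAnnihilator.IsSyzygy (n + 1) X N →
        ∃ L : ModuleCat.{0} C,
          Literature.RingTheory.CohomologyAnnihilator.IsSyzygy 1
              (ModuleCat.of C (N ⧸ (x • (⊤ : Submodule C N)))) L ∧
            ∃ (i : N ⟶ L) (p : L ⟶ N), i ≫ p = 𝟙 N := by
  refine ⟨exists_forall_isSyzygy_retract_of_mem hx, fun ⟨n, h⟩ => ?_⟩
  exact mem_cohomologyAnnihilator_iff.mpr
    ⟨n + 2, mem_cohomologyAnnihilatorOfDegree_of_forall_isSyzygy_retract h⟩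

end Summit.ResolutionOfSingularities.ResolutionOfSingularities.Theorems.HomologicalConductor.PersistenceReductionModX

end
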